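import Summits.Ventures.Crystal3D.Theorems.StickyWulffConstantCoaxialWallLawTailResidueClosingM
import Summits.Ventures.Crystal3D.Theorems.StickyWulffConstantCoaxialWallLawLensSoundnessReduction
import Summits.Ventures.Crystal3D.Theorems.StickyWulffConstantCoaxialWallLawOnSiteBridge
import HarnessLib

/-!
# `MonoCapture` HOLDS — the canonical-typing half of the split T4 (crux `CoaxialWallLaw`, stmt-Ventures-19481; cf-p1 (cxxxii))

HONEST FRAMING. Venture `Summits/Ventures/Crystal3D` (cell `crystal3d-full`); helper `--supports` the crux `CoaxialWallLaw`
(stmt-Ventures-19481, `route-Ventures-StickyWulffConstant`), registered line 'CoaxialWallLawCertificates' (planner cf-p1).  Census-free;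
F-C1 not moved.  Proves `TailResidue.MonoCapture` (…TailResidueDefsM): at an off-site payer window that is CAPTURED (some placement `S` and
some standard `L₀` make every (A)-end pair near the payer a flat end pair of the exact part for `L₀`'s joint systems), the joint summand of
`L` is bounded by the row of the canonical lens type of the transported window:
* `image_rigid_symm`, `trans_trans_symm`, `isEndPairA_transport_iff`, `endMultA_transport`, **`localSummandA_transport`** — the (A)
  summand is invariant under rigid motions with the plate systems' base frames transported (completes `…OnSiteBridge`'s one-way transport);
* `endMultA_le_endMultFlat_of_dust'`, **`localSummandA_le_localSummandFlatDecL_of_dust'`** — the decoration lemma of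
  `…DustDecorationLens` with the systems CHANGED on the exact side (`hD` lands in the joint systems of `L₀`);
* `localSummandA_le_row_typeOf'` — module coordinates: summand of `L` at `0` ≤ `(typeOf X).row L₀` under such an `hD`;
* **`monoCapture : MonoCapture`**; `coaxialWallLaw_of_lensCertificates_mono_explicit₉` — the crux cone with `MonoCapture` discharged
  (nine named hypotheses: kissing gap / classification, StarPairFar, P5Exhaustion, two on-site flats, `LensCert (2√6)`, `ModuleCapture`,
  `MultiGrainSmall (2√6)`).
WHAT THIS IS NOT: not `ModuleCapture` (generalized class collapse), not `MultiGrainSmall`; F-C1 not moved.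
-/

noncomputable section
namespace Summit.Ventures.Crystal3D.Theorems

namespace TailResidue

open Summit.Ventures.Crystal3D Finset
open scoped InnerProductSpace

/-! ### Transport of the (A) summand under a rigid motion -/

section Transport

variable (X : Finset (EuclideanSpace ℝ (Fin 3))) (S : EuclideanSpace ℝ (Fin 3) ≃ₗᵢ[ℝ] EuclideanSpace ℝ (Fin 3))
  (c : EuclideanSpace ℝ (Fin 3)) (v : WordVersion) (L₁ L₂ : EuclideanSpace ℝ (Fin 3) ≃ₗᵢ[ℝ] EuclideanSpace ℝ (Fin 3))
  (R₁ R₂ : Finset (EuclideanSpace ℝ (Fin 3)))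

/-- The inverse motion undoes the motion on configurations. -/
theorem image_rigid_symm : ((X.image fun x => S x + c).image fun x => S.symm x + -S.symm c) = X := by
  rw [Finset.image_image]
  convert Finset.image_id (s := X) using 2
  funext x
  simp [Function.comp, map_add]

/-- Frames: `(L.trans S).trans S.symm = L`. -/
theorem trans_trans_symm (L : EuclideanSpace ℝ (Fin 3) ≃ₗᵢ[ℝ] EuclideanSpace ℝ (Fin 3)) : (L.trans S).trans S.symm = L := by
  ext x; simp

open scoped Classical in
/-- **(A)-end pairs transport both ways.** -/
theorem isEndPairA_transport_iff {b q : EuclideanSpace ℝ (Fin 3)} :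
    IsEndPairA (X.image fun x => S x + c) v ⟨L₁.trans S, R₁⟩ ⟨L₂.trans S, R₂⟩ (S b + c) (S q + c) ↔
      IsEndPairA X v ⟨L₁, R₁⟩ ⟨L₂, R₂⟩ b q := by
  constructor
  · intro h
    have h' := isEndPairA_transport S.symm (-S.symm c) (L₁.trans S) (L₂.trans S) R₁ R₂ h
    rw [image_rigid_symm, trans_trans_symm, trans_trans_symm] at h'
    have e1 : S.symm (S b + c) + -S.symm c = b := by simp [map_add]
    have e2 : S.symm (S q + c) + -S.symm c = q := by simp [map_add]
    rwa [e1, e2] at h'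
  · exact isEndPairA_transport S c L₁ L₂ R₁ R₂

open scoped Classical in
/-- **Multiplicities transport.** -/
theorem endMultA_transport (b : EuclideanSpace ℝ (Fin 3)) :
    endMultA (X.image fun x => S x + c) v ⟨L₁.trans S, R₁⟩ ⟨L₂.trans S, R₂⟩ (S b + c) = endMultA X v ⟨L₁, R₁⟩ ⟨L₂, R₂⟩ b := by
  unfold endMultA
  have hset : ((X.image fun x => S x + c).filter fun q => IsEndPairA (X.image fun x => S x + c) v ⟨L₁.trans S, R₁⟩ ⟨L₂.trans S, R₂⟩
        (S b + c) q) = (X.filter fun q => IsEndPairA X v ⟨L₁, R₁⟩ ⟨L₂, R₂⟩ b q).image fun x => S x + c := by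
    ext y
    simp only [mem_filter, mem_image]
    constructor
    · rintro ⟨⟨x, hx, rfl⟩, hp⟩
      exact ⟨x, ⟨hx, (isEndPairA_transport_iff X S c v L₁ L₂ R₁ R₂).1 hp⟩, rfl⟩
    · rintro ⟨x, ⟨hx, hp⟩, rfl⟩
      exact ⟨⟨x, hx, rfl⟩, (isEndPairA_transport_iff X S c v L₁ L₂ R₁ R₂).2 hp⟩
  rw [hset, card_image_of_injective _ (rigid_injective S c)]

open scoped Classical in
/-- **THE (A) SUMMAND TRANSPORTS** under a rigid motion, the plate systems' base frames transported. -/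
theorem localSummandA_transport (z : EuclideanSpace ℝ (Fin 3)) :
    localSummandA v ⟨L₁.trans S, R₁⟩ ⟨L₂.trans S, R₂⟩ (X.image fun x => S x + c) (S z + c) = localSummandA v ⟨L₁, R₁⟩ ⟨L₂, R₂⟩ X z := by
  unfold localSummandA
  have hset : ((X.image fun x => S x + c).filter fun b => dist (S z + c) b ≤ 1 ∧
        0 < endMultA (X.image fun x => S x + c) v ⟨L₁.trans S, R₁⟩ ⟨L₂.trans S, R₂⟩ b) =
      (X.filter fun b => dist z b ≤ 1 ∧ 0 < endMultA X v ⟨L₁, R₁⟩ ⟨L₂, R₂⟩ b).image fun x => S x + c := by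
    ext y
    simp only [mem_filter, mem_image]
    constructor
    · rintro ⟨⟨x, hx, rfl⟩, hd, hpos⟩
      rw [dist_rigid] at hd
      rw [endMultA_transport] at hpos
      exact ⟨x, ⟨hx, hd, hpos⟩, rfl⟩
    · rintro ⟨x, ⟨hx, hd, hpos⟩, rfl⟩
      exact ⟨⟨x, hx, rfl⟩, by rw [dist_rigid]; exact hd, by rw [endMultA_transport]; exact hpos⟩
  rw [hset, sum_image fun x _ y _ h => rigid_injective S c h]
  refine sum_congr rfl fun b _ => ?_
  rw [endMultA_transport, pooledDef_transport]

end Transport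

/-! ### The decoration lemma with the systems changed on the exact side -/

section Decoration

variable {X X₀ : Finset (EuclideanSpace ℝ (Fin 3))} {z : EuclideanSpace ℝ (Fin 3)} {v : WordVersion} {S₁ S₂ S₁' S₂' : PlateSystem}
  (hsub : X₀ ⊆ X) (hz : z ∈ X₀)
  (hD : ∀ b q : EuclideanSpace ℝ (Fin 3), dist z b ≤ 1 → IsEndPairA X v S₁ S₂ b q → IsEndPairFlat X₀ v S₁' S₂' b q)

include hD in
open scoped Classical in
/-- Multiplicities under `hD` with changed systems. -/
theorem endMultA_le_endMultFlat_of_dust' {b : EuclideanSpace ℝ (Fin 3)} (hzb : dist z b ≤ 1) :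
    endMultA X v S₁ S₂ b ≤ endMultFlat X₀ v S₁' S₂' b := by
  unfold endMultA endMultFlat
  refine card_le_card fun q hq => ?_
  have h := hD b q hzb (mem_filter.1 hq).2
  exact mem_filter.2 ⟨h.1, h⟩

include hsub hz hD in
open scoped Classical in
/-- **DECORATION LEMMA, systems changed on the exact side**: verbatim `localSummandA_le_localSummandFlatDecL_of_dust` with the flat end
pairs of `X₀` taken for the systems `(S₁', S₂')`. -/
theorem localSummandA_le_localSummandFlatDecL_of_dust' :
    localSummandA v S₁ S₂ X z ≤ localSummandFlatDecL v S₁' S₂' X₀ (dustDeg X X₀) z := by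
  have _ := hz
  unfold localSummandA localSummandFlatDecL
  have hp : ∀ b, 0 ≤ pooledDefFlatDecL X₀ (dustDeg X X₀) b := fun b => pooledDefFlatDecL_nonneg b
  calc ∑ b ∈ X.filter (fun b => dist z b ≤ 1 ∧ 0 < endMultA X v S₁ S₂ b), (endMultA X v S₁ S₂ b : ℝ) / pooledDef X b
      ≤ ∑ b ∈ X.filter (fun b => dist z b ≤ 1 ∧ 0 < endMultA X v S₁ S₂ b),
          (endMultFlat X₀ v S₁' S₂' b : ℝ) / pooledDefFlatDecL X₀ (dustDeg X X₀) b := by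
        refine sum_le_sum fun b hb => ?_
        obtain ⟨hbX, hzb, hpos⟩ := mem_filter.1 hb
        have hb0 : b ∈ X₀ := by
          unfold endMultA at hpos
          obtain ⟨q, hq⟩ := card_pos.1 hpos
          exact (hD b q hzb (mem_filter.1 hq).2).2.1
        have hpay : HasTwoPayers X b := by
          unfold endMultA at hpos
          obtain ⟨q, hq⟩ := card_pos.1 hpos
          exact (mem_filter.1 hq).2.2.2.1
        have hpd : pooledDefFlatDecL X₀ (dustDeg X X₀) b ≤ pooledDef X b := pooledDefFlatDecL_le_pooledDef hsub hpay
        have hpd0 : 0 < pooledDefFlatDecL X₀ (dustDeg X X₀) b := lt_of_lt_of_le zero_lt_one (one_le_pooledDefFlatDecL hb0)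
        calc (endMultA X v S₁ S₂ b : ℝ) / pooledDef X b
            ≤ (endMultA X v S₁ S₂ b : ℝ) / pooledDefFlatDecL X₀ (dustDeg X X₀) b :=
              div_le_div_of_nonneg_left (Nat.cast_nonneg _) hpd0 hpd
          _ ≤ (endMultFlat X₀ v S₁' S₂' b : ℝ) / pooledDefFlatDecL X₀ (dustDeg X X₀) b :=
              div_le_div_of_nonneg_right (by exact_mod_cast endMultA_le_endMultFlat_of_dust' hD hzb) (hp b)
    _ ≤ ∑ b ∈ X₀.filter (fun b => dist z b ≤ 1 ∧ 0 < endMultFlat X₀ v S₁' S₂' b),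
          (endMultFlat X₀ v S₁' S₂' b : ℝ) / pooledDefFlatDecL X₀ (dustDeg X X₀) b := by
        refine sum_le_sum_of_subset_of_nonneg (fun b hb => ?_) fun b _ _ => div_nonneg (Nat.cast_nonneg _) (hp b)
        obtain ⟨hbX, hzb, hpos⟩ := mem_filter.1 hb
        have hb0 : b ∈ X₀ := by
          unfold endMultA at hpos
          obtain ⟨q, hq⟩ := card_pos.1 hpos
          exact (hD b q hzb (mem_filter.1 hq).2).2.1
        exact mem_filter.2 ⟨hb0, hzb, lt_of_lt_of_le hpos (endMultA_le_endMultFlat_of_dust' hD hzb)⟩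

end Decoration

/-! ### The capture in module coordinates, and `MonoCapture` -/

set_option maxRecDepth 65536 in
open scoped Classical in
/-- **In module coordinates**: if every (A)-end pair of `X` (joint systems of any `L`) near the payer `0` is a flat end pair of `exactOf X` for
the joint systems of a frame `L₀`, the summand of `L` at `0` is at most `(typeOf X).row L₀`. -/
theorem localSummandA_le_row_typeOf' {X : Finset (EuclideanSpace ℝ (Fin 3))} (h0 : (0 : EuclideanSpace ℝ (Fin 3)) ∈ X)
    (L L₀ : EuclideanSpace ℝ (Fin 3) ≃ₗᵢ[ℝ] EuclideanSpace ℝ (Fin 3))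
    (hD : ∀ b q : EuclideanSpace ℝ (Fin 3), dist (0 : EuclideanSpace ℝ (Fin 3)) b ≤ 1 →
      IsEndPairA X WordVersion.v2 (basalSystem L)
        (basalSystem (((ℝ ∙ EuclideanSpace.single (2 : Fin 3) (1 : ℝ)).reflection).trans L)) b q →
      IsEndPairFlat (exactOf X) WordVersion.v2 (basalSystem L₀)
        (basalSystem (((ℝ ∙ EuclideanSpace.single (2 : Fin 3) (1 : ℝ)).reflection).trans L₀)) b q) :
    localSummandA WordVersion.v2 (basalSystem L)
      (basalSystem (((ℝ ∙ EuclideanSpace.single (2 : Fin 3) (1 : ℝ)).reflection).trans L)) X 0 ≤ (typeOf X).row L₀ := by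
  have h1 := localSummandA_le_localSummandFlatDecL_of_dust' (exactOf_subset X) (zero_mem_exactOf h0) hD
  refine h1.trans (le_of_eq ?_)
  rw [LensType.row, typeOf_realise]
  refine localSummandFlatDecL_congr fun y hy hzy => ?_
  rw [looseAt_typeOf_eq_dustDeg X hy (by rwa [dist_eq_norm, zero_sub, norm_neg] at hzy)]

set_option maxRecDepth 65536 in
open scoped Classical in
/-- **`MonoCapture` HOLDS** (the canonical-typing half of T4): transport the window to the payer (`shifted`), apply the decoration lemma with
the systems moved to the standard frame `L₀` of `CapturedAt`, and read the result as the row of the canonical type `typeOf`. -/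
theorem monoCapture : MonoCapture := by
  intro L X hX z hz hdeg _hoff hcap
  obtain ⟨S, L₀, hL₀, hD⟩ := hcap
  right
  -- the transported window
  set Y : Finset (EuclideanSpace ℝ (Fin 3)) := shifted S z X with hY
  have hYdef : Y = X.image fun x => S.symm x + -S.symm z := rfl
  have h0 : S.symm z + -S.symm z = (0 : EuclideanSpace ℝ (Fin 3)) := add_neg_cancel _
  have hYsep : ∀ p ∈ Y, ∀ q ∈ Y, p ≠ q → 1 ≤ dist p q := by
    intro p hp q hq hne
    rw [hYdef] at hp hq
    obtain ⟨x, hx, rfl⟩ := mem_image.1 hp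
    obtain ⟨y, hy, rfl⟩ := mem_image.1 hq
    rw [dist_rigid]
    exact hX x hx y hy fun h => hne (by rw [h])
  have hY0 : (0 : EuclideanSpace ℝ (Fin 3)) ∈ Y := by
    rw [hYdef, ← h0]; exact mem_image_of_mem _ hz
  have hYdeg : (Y.filter fun q => dist (0 : EuclideanSpace ℝ (Fin 3)) q = 1).card ≤ 11 := by
    rw [hYdef, ← h0, degree_transport]; exact hdeg
  refine ⟨typeOf Y, typeOf_wellFormed hYsep hY0 hYdeg, typeOf_realisable hYsep, L₀, hL₀, ?_⟩
  -- transport the summand and conclude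
  have ht := localSummandA_transport X S.symm (-S.symm z) WordVersion.v2 L
    (((ℝ ∙ EuclideanSpace.single (2 : Fin 3) (1 : ℝ)).reflection).trans L) basalHexagon basalHexagon z
  rw [h0] at ht
  have key := localSummandA_le_row_typeOf' hY0 (L.trans S.symm) L₀ hD
  rw [basalSystem, basalSystem] at key ⊢
  rw [← ht]
  exact key

end TailResidue

open TailResidue in
/-- **The same with `MonoCapture` already discharged** (`TailResidue.monoCapture`): nine hypotheses. -/
theorem coaxialWallLaw_of_lensCertificates_mono_explicit₉ (hg : KissingGap (5 / 2)) (hc : KissingClassification (5 / 2))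
    (hSP : StarPairFar) (hE1 : P5Exhaustion) (honT : EndRowOnSiteFlatA WordVersion.v2 (9 / 2) coaxialModuleUniverse)
    (honJ : EndRowOnSiteJointFlatA WordVersion.v2 (2 * Real.sqrt 6) coaxialModuleUniverse)
    (hcert : LensCert (2 * Real.sqrt 6)) (hmod : ModuleCapture) (hmulti : MultiGrainSmall (2 * Real.sqrt 6)) :
    Summit.Ventures.Crystal3D.Theses.StickyWulffConstant.CoaxialWallLaw :=
  coaxialWallLaw_of_lensCertificates_mono_explicit hg hc hSP hE1 honT honJ hcert monoCapture hmod hmulti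

end Summit.Ventures.Crystal3D.Theorems

end
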